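import Literature.NumberTheory.Automorphic.AshSmithTheoryHeckeEigencharacterProofs
import HarnessLib

/-!
# Ash (2003), *Smith theory and Hecke operators*: decomposition of the named fact into its
# automorphic half (Theorem 4.3, the Smith-theory eigenclass with eigencharacter `χ_θ`)

Decomposition record (librarian, mode `fact-decompose`, 2026-08-16) for the XL named fact
`Literature.NumberTheory.Automorphic.Ash2003_inducedRayClassCharacter_attached`
(`AshSmithTheoryHecke`; A. Ash, J. Algebra 259 (2003) 43–58 [Ash2003], Thm. 1.1 / Cor. 4.4: for a
mod-`p` ray class character `θ` of `ℚ(ζ_p)` modulo `(pN)` with Galois avatar `ϑ`, the induced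
representation `Ind ϑ : Γ_ℚ → GL_{p-1}(F)` is attached to a Hecke eigenclass in `H^*(X(pN), F)`).

**Decision: SPLIT, one child (new named fact) + proved glue.** The printed proof has two halves:
(Galois) Lemma 4.2 — `Ind θ` is attached to the EXPLICIT eigencharacter
`χ_θ(T_{l,k}) = ∑_Q θ([λ_Q]) = e_{k/d}((θ([w]))_{w ∣ l})` (`d = ord_p(l)`, `0` if `d ∤ k`) — which is
PROVED in the tree (`Ash2003.isAttached_induce_esymm`, `AshSmithTheoryHeckeEigencharacterProofs`,
with the unramifiedness and Frobenius files); and (automorphic) Theorem 4.3 / Cor. 4.4 — `χ_θ`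
OCCURS as the eigenvalue system of a Hecke eigenclass in the mod-`p` (co)homology of `X(pN)`
(Smith theory for the order-`p` element `π`, Lemmas 2.1–4.1, 5.7, Thm. 6.2) — which is not in the
tree (no topological model of `X(M)`; `Ash2003.cohomology` is group cohomology). This file names
the automorphic half:

* `Ash2003.eigencharacter p N θ` — the explicit eigenvalue system `χ_θ : (v, k) ↦ F` (definition,
  character-for-character the system of `Ash2003.isAttached_induce_esymm`);
* child (new): `Ash2003_thm43_eigenclass` — **Theorem 4.3 (with Cor. 4.4)**: there is a Hecke
  eigenclass `α ∈ H^i(X(pN), F)` (`Ash2003.IsEigenclass`) with eigenvalues `χ_θ` — a statement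
  about Hecke operators on arithmetic cohomology only (no Galois representation, no avatar), hence
  not a restatement of the parent;
* glue (proved): `Ash2003_inducedRayClassCharacter_attached_holds_of : Ash2003_thm43_eigenclass →
  Ash2003_inducedRayClassCharacter_attached` (the child supplies `i, α`; Lemma 4.2 =
  `isAttached_induce_esymm` supplies `IsAttached`).

## References

* A. Ash, *Smith theory and Hecke operators*, J. Algebra 259 (2003) 43–58: Thm. 1.1, Lemma 4.2,
  Thm. 4.3, Cor. 4.4 (p. 50), Thm. 6.2. [Ash2003]
-/

noncomputable section

open scoped NumberField
open IsDedekindDomain Polynomial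

namespace Literature.NumberTheory.Automorphic

namespace Ash2003

open GaloisRepresentations

open scoped Classical in
/-- **Ash's explicit eigencharacter `χ_θ`** ([Ash2003, Thm. 4.3]: `χ_θ(T_{l,k}) = ∑_Q θ([λ_Q])`,
the sum over the `(k/d)`-element sets `Q` of primes of `L = ℚ(ζ_p)` above `l`, `d` their common
residue degree, `λ_Q = ∏_{w ∈ Q} w`): as a system of Hecke eigenvalues `(v, k) ↦ F` it is
`e_{k/d}((θ([w]))_{w ∣ l})` (`Multiset.esymm` of the values of `θ` on the ray classes of the
finitely many places `w` of `ℚ(ζ_p)` above `l = q_v`, read as `0` at places not coprime to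
`(pN)`, which do not occur above `l ∤ pN`) when `d = ord_p(l) ∣ k`, and `0` otherwise — exactly the
system to which `Ind ϑ` is attached in `Ash2003.isAttached_induce_esymm`.
[cite: Ash2003, Thm. 4.3 and Thm. 6.2] -/
def eigencharacter (p : ℕ) [hp : Fact p.Prime] (N : ℕ) (hN : N ≠ 0) {F : Type*} [Field F]
    (θ : RayClassGroup (modulus (CyclotomicField p ℚ) (p * N)) →* Fˣ) :
    HeightOneSpectrum (𝓞 ℚ) → ℕ → F := fun v k =>
  if orderOf (v.residueCard : ZMod p) ∣ k then
    (((Set.finite_coe_iff.1 (finite_heightOneSpectrum_under_eq (M := CyclotomicField p ℚ) v)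
        ).toFinset.val.map fun w : HeightOneSpectrum (𝓞 (CyclotomicField p ℚ)) =>
          if hw : IsCoprime w.asIdeal (modulus (CyclotomicField p ℚ) (p * N)) then
            ((θ (integralRayClass (modulus (CyclotomicField p ℚ) (p * N))
              (modulus_ne_bot (CyclotomicField p ℚ) (mul_ne_zero (Nat.Prime.ne_zero hp.out) hN))
              ⟨w.asIdeal, w.ne_bot, hw⟩) : Fˣ) : F)
          else 0).esymm
      (k / orderOf (v.residueCard : ZMod p)))
  else 0

/-- Lemma 4.2 in terms of `Ash2003.eigencharacter`: `Ind ϑ` is attached to `χ_θ`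
(`Ash2003.isAttached_induce_esymm`, definitional unfolding). [cite: Ash2003, Lemma 4.2 and Thm. 4.3] -/
theorem isAttached_induce_eigencharacter (p : ℕ) [hp : Fact p.Prime] {N : ℕ} (hN : N ≠ 0)
    {F : Type*} [Field F] [Algebra (ZMod p) F] [TopologicalSpace F]
    (θ : RayClassGroup (modulus (CyclotomicField p ℚ) (p * N)) →* Fˣ)
    (ϑ : FramedGaloisRep (CyclotomicField p ℚ) F 1)
    (hϑ : IsGaloisAvatar
      (modulus_ne_bot (CyclotomicField p ℚ) (mul_ne_zero (Nat.Prime.ne_zero hp.out) hN)) θ ϑ) :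
    IsAttached p (p * N) (FramedGaloisRep.induce ℚ (finrank_cyclotomicField p) ϑ)
      (eigencharacter p N hN θ) :=
  isAttached_induce_esymm p hN θ ϑ hϑ

end Ash2003

/-- **Ash (2003), Theorem 4.3 with Corollary 4.4 — the automorphic half** (named fact, child of
the decomposition of `Ash2003_inducedRayClassCharacter_attached`). For an odd prime `p`, `N ≥ 1`
prime to `p`, `F` an algebraic closure of `𝔽_p` (discrete) and a character `θ` of the ray class
group of `L = ℚ(ζ_p)` of modulus `(pN)`, the explicit eigencharacter `χ_θ`
(`Ash2003.eigencharacter`: `χ_θ(T_{l,k}) = ∑_Q θ([λ_Q])`) OCCURS in the mod-`p` cohomology of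
`X(pN)`: there are a degree `i` and a Hecke eigenclass `α ≠ 0` in
`H^i(X(pN), F) = ⊕_{(ℤ/pN)^×} H^i(Γ(pN), F)` (`Ash2003.cohomology`, `Ash2003.IsEigenclass`) with
`T_{l,k} α = χ_θ(l, k) α` for all `l ∤ pN`, `0 ≤ k ≤ p - 1`. Printed: Thm. 4.3 "`χ_θ` occurs as an
eigencharacter of `ℋ` in `H_*(X_M ; F)`" (from Lemma 4.1, Lemma 5.7 — `E` acts simply transitively
on the components of `X_M` — and Thm. 6.2 — `T_s` acts through the classes `[λ_Q]`), lifted to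
`H_*(X)` by the Smith-theory Lemmas 2.1–2.2, 3.1–3.3 (Cor. 4.4), homology and cohomology being
interchangeable (p. 46; see the module docstring of `AshSmithTheoryHecke` for the typing of `X(M)`,
`K_∞`, `T_{l,k}`). The Galois side (Lemma 4.2) is the theorem `Ash2003.isAttached_induce_eigencharacter`.
[cite: Ash2003, Thm. 4.3 and Cor. 4.4 (p. 50)] -/
def Ash2003_thm43_eigenclass : Prop :=
  ∀ (p : ℕ) [Fact p.Prime], p ≠ 2 →
    ∀ (N : ℕ) (hN : N ≠ 0), ¬ p ∣ N →
    ∀ (F : Type) [Field F] [Algebra (ZMod p) F] [IsAlgClosure (ZMod p) F] [TopologicalSpace F]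
      [DiscreteTopology F]
      (θ : GaloisRepresentations.RayClassGroup (Ash2003.modulus (CyclotomicField p ℚ) (p * N)) →* Fˣ),
      ∃ (i : ℕ) (α : Ash2003.cohomology (p - 1) (p * N) F i),
        Ash2003.IsEigenclass (p - 1) (p * N) F i α (Ash2003.eigencharacter p N hN θ)

/-- **Glue of the decomposition of `Ash2003_inducedRayClassCharacter_attached`**: Theorem 1.1 /
Cor. 4.4 follows from its automorphic half (`Ash2003_thm43_eigenclass`, Thm. 4.3: the eigenclass
with eigencharacter `χ_θ` exists) and the Galois half proved in the tree
(`Ash2003.isAttached_induce_eigencharacter` = Lemma 4.2: `Ind ϑ` is attached to `χ_θ`).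
[cite: Ash2003, Thm. 1.1, Lemma 4.2, Thm. 4.3 and Cor. 4.4] -/
theorem Ash2003_inducedRayClassCharacter_attached_holds_of (h : Ash2003_thm43_eigenclass) :
    Ash2003_inducedRayClassCharacter_attached := by
  intro p _ hp2 N hN hpN F _ _ _ _ _ θ ϑ hϑ
  obtain ⟨i, α, hα⟩ := h p hp2 N hN hpN F θ
  exact ⟨i, α, Ash2003.eigencharacter p N hN θ, hα,
    Ash2003.isAttached_induce_eigencharacter p hN θ ϑ hϑ⟩

end Literature.NumberTheory.Automorphic

end
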